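import Literature.NumberTheory.GaloisRepresentations.LocalFieldCdTwo
import Literature.NumberTheory.GaloisRepresentations.UnramifiedClassesInertia
import Literature.NumberTheory.GaloisRepresentations.HOneUnramifiedProcyclic
import Literature.NumberTheory.GaloisRepresentations.ContinuousH2
import HarnessLib

/-!
# The cup product of two unramified classes vanishes (any finite `p`-primary value module)

Topic `NumberTheory/GaloisRepresentations` (sequel to `UnramifiedClassesInertia`, `LocalFieldCdTwo`
(`groupCdLE_one_quotient_galUnr`: `cd_p(Gal(F^nr/F)) ≤ 1`), `ContinuousH2` (explicit cup-product `2`-cocycles)).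
Theorems only; no definition, no named fact, no instance, no `sorry`.

Let `F` be a non-archimedean local field, `I_F = Gal(F̄/F^nr)` (`galUnr F = absInertia F`), and let
`A × B → C` be a `Γ_F`-equivariant pairing of discrete `Γ_F`-modules (`ContPairing`) with `C` `p`-primary torsion.
**For `x ∈ H¹_ur(F, A)` and `y ∈ H¹_ur(F, B)` the cup product `x ∪ y ∈ H²(F, C)` vanishes**
(`ContPairing.cupProduct_eq_zero_of_mem_unramifiedSubgroup`).  This is the first half of Milne, *ADT*, I Thm. 2.6 /
Rubin, *Euler systems and Kolyvagin systems* (PCMI 2011) Prop. 1.9.1 and Exercise 1.9.3: «`H¹_u(K, A)` and `H¹_u(K, A*)`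
are orthogonal because … `Inf ∪ Inf` lands in `H²(K^ur/K, ·) = 0`» — valid for EVERY finite (possibly ramified) module,
the value group being `p`-primary.  Mechanism (continuous cochains): an unramified class is represented by a cocycle
VANISHING on `I_F` (`exists_oneCocycleClass_eq_forall_galUnr_eq_zero`, from `oneCocycleClass_mem_unramifiedSubgroup_iff_exists`);
for such `f`, `g` the cup-product cocycle `(σ, τ) ↦ ⟨f σ, σ g τ⟩` takes values in `C^{I_F}` and is inflated from a
continuous `2`-cocycle of `Gal(F^nr/F) = Γ_F ⧸ I_F` (`quotientInvariants`), whose class vanishes because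
`cd_p(Γ_F ⧸ I_F) ≤ 1` (`groupCdLE_one_quotient_galUnr`).

WHY (cell `pub/bsd-print-x9`, Howard 2004 H.4 at the places `v ∣ N`): the levelwise ISOTROPY of the unramified cores
`H¹_ur(K_v, T_𝔮/𝔪^k) ∪ H¹_ur(K_v̄, T_𝔮/𝔪^k)^τ = 0` for the (ramified at `v ∣ N`) levels of Howard's `T_𝔮`, input (Iso) of
the saturated-condition descent (`TowerSaturatedAnnihilatorProofs`); it also discharges, unconditionally, the isotropy
half of `LocalInvariants.UnramifiedOrthogonal`.  BSD is not proved by any of this.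

References: [MilneADT2006] J. S. Milne, *Arithmetic Duality Theorems* (2006), I Thm. 2.6; [Rubin2011] K. Rubin, *Euler
systems and Kolyvagin systems* (PCMI 18, 2011), Prop. 1.9.1, Ex. 1.9.3, Prop. 1.4.10(2); [SerreGaloisCohomology1997]
I §2.6, II §4.3 Prop. 12.
-/

noncomputable section

open CategoryTheory Function Field ValuativeRel

universe u

namespace Literature.NumberTheory.GaloisRepresentations

open IsNonarchimedeanLocalField
open _root_.TopRep _root_.ContinuousCohomology

variable {F : Type u} [Field F] [ValuativeRel F] [TopologicalSpace F] [IsNonarchimedeanLocalField F]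
variable {A B C : Type u} [AddCommGroup A] [TopologicalSpace A] [DiscreteTopology A]
  [AddCommGroup B] [TopologicalSpace B] [DiscreteTopology B]
  [AddCommGroup C] [TopologicalSpace C] [DiscreteTopology C]

namespace DiscreteGaloisModule

/-! ## §1 Unramified classes are represented by cocycles vanishing on the inertia group -/

/-- **An unramified class has a representative cocycle VANISHING on `I_F = galUnr F`** (a representative principal on
`I_F`, minus the corresponding coboundary). [cite: MilneADT2006, Ch. I §2 (unramified cohomology)]
[cite: SerreGaloisCohomology1997, I §2.6 (b)] -/
theorem exists_oneCocycleClass_eq_forall_galUnr_eq_zero (ρ : DiscreteGaloisModule F A) {x : galoisCohomology ρ 1}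
    (hx : x ∈ ρ.unramifiedSubgroup 1) :
    ∃ f : contOneCocycles ρ.toTopRep, oneCocycleClass _ f = x ∧ ∀ n ∈ galUnr F, f.1 n = 0 := by
  obtain ⟨f₀, rfl⟩ := oneCocycleClass_surjective ρ.toTopRep x
  obtain ⟨w, hw⟩ := (ρ.oneCocycleClass_mem_unramifiedSubgroup_iff_exists f₀).mp hx
  have hres : resSubgroup ρ.toTopRep (galUnr F) 1 (oneCocycleClass _ f₀) = 0 := by
    rw [resSubgroup_oneCocycleClass, oneCocycleClass_eq_zero_iff]
    exact ⟨w, fun n => by rw [resSubgroup_pullback_apply]; exact hw n (galUnr_le_absInertia F n.2)⟩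
  obtain ⟨f, hf, hfN⟩ :=
    exists_rep_vanishing_of_resSubgroup_eq_zero (X := ρ.toTopRep) (N := galUnr F) ρ.continuous_smul _ hres
  exact ⟨f, hf, fun n hn => hfN ⟨n, hn⟩⟩

/-- A cocycle vanishing on a normal subgroup is constant on its cosets: `f (σ n) = f σ`.
[cite: SerreGaloisCohomology1997, I §2.6] -/
theorem apply_mul_eq_of_vanishing (ρ : DiscreteGaloisModule F A) (f : contOneCocycles ρ.toTopRep)
    (hf : ∀ n ∈ galUnr F, f.1 n = 0) (σ : absoluteGaloisGroup F) {n : absoluteGaloisGroup F} (hn : n ∈ galUnr F) :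
    f.1 (σ * n) = f.1 σ := by
  rw [f.2 σ n, hf n hn, map_zero, add_zero]

/-- … and takes `I_F`-invariant values: `n • f σ = f σ`. [cite: SerreGaloisCohomology1997, I §2.6] -/
theorem smul_apply_eq_of_vanishing (ρ : DiscreteGaloisModule F A) (f : contOneCocycles ρ.toTopRep)
    (hf : ∀ n ∈ galUnr F, f.1 n = 0) (σ : absoluteGaloisGroup F) {n : absoluteGaloisGroup F} (hn : n ∈ galUnr F) :
    ρ n (f.1 σ) = f.1 σ := by
  have h1 : f.1 (n * σ) = ρ n (f.1 σ) := by
    rw [f.2 n σ, hf n hn, zero_add]; rfl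
  have h2 : f.1 (n * σ) = f.1 σ := by
    have hc : σ⁻¹ * n * σ ∈ galUnr F := Subgroup.Normal.conj_mem' inferInstance n hn σ
    have := ρ.apply_mul_eq_of_vanishing f hf σ hc
    rwa [show σ * (σ⁻¹ * n * σ) = n * σ by group] at this
  rw [← h1, h2]

end DiscreteGaloisModule

/-! ## §2 The cup product of unramified classes vanishes -/

namespace ContPairing

open DiscreteGaloisModule

/-- **`x ∪ y = 0` for unramified `x ∈ H¹_ur(F, A)`, `y ∈ H¹_ur(F, B)`** and any equivariant pairing `A × B → C` into a
`p`-primary discrete module `C` (first half of Milne I Thm. 2.6 / Rubin PCMI Prop. 1.9.1, for arbitrary — possibly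
ramified — finite modules: the cup product is inflated from `H²(Gal(F^nr/F), C^{I_F}) = 0`, `cd_p Ẑ = 1`).
[cite: MilneADT2006, Ch. I, Thm. 2.6] [cite: Rubin2011, Prop. 1.9.1 and Ex. 1.9.3]
[cite: SerreGaloisCohomology1997, II §4.3 Prop. 12] -/
theorem cupProduct_eq_zero_of_mem_unramifiedSubgroup {p : ℕ} [Fact p.Prime]
    {ρ₁ : DiscreteGaloisModule F A} {ρ₂ : DiscreteGaloisModule F B} {ρ₃ : DiscreteGaloisModule F C}
    (hC : IsPrimaryTorsion p C) (P : ContPairing ρ₁.toTopRep ρ₂.toTopRep ρ₃.toTopRep)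
    {x : galoisCohomology ρ₁ 1} {y : galoisCohomology ρ₂ 1}
    (hx : x ∈ ρ₁.unramifiedSubgroup 1) (hy : y ∈ ρ₂.unramifiedSubgroup 1) :
    haveI : CompactSpace (absoluteGaloisGroup F) := absoluteGaloisGroup_compactSpace F
    P.cupProduct x y = 0 := by
  haveI : CompactSpace (absoluteGaloisGroup F) := absoluteGaloisGroup_compactSpace F
  -- representatives vanishing on `I_F`
  obtain ⟨f, rfl, hf⟩ := ρ₁.exists_oneCocycleClass_eq_forall_galUnr_eq_zero hx
  obtain ⟨g, rfl, hg⟩ := ρ₂.exists_oneCocycleClass_eq_forall_galUnr_eq_zero hy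
  set S : Subgroup (absoluteGaloisGroup F) := galUnr F with hS
  -- the cup cocycle takes `I_F`-invariant values and is constant on `I_F`-cosets
  have hval : ∀ σ τ : absoluteGaloisGroup F,
      (P.cupCocycle f g).1 (σ, τ) ∈ Representation.invariants (ρ₃.toRepresentation.comp S.subtype) := by
    intro σ τ n
    rw [cupCocycle_apply_eq_smul]
    change ρ₃ (n : absoluteGaloisGroup F) (P.toLin (f.1 σ) (ρ₂ σ (g.1 τ))) = P.toLin (f.1 σ) (ρ₂ σ (g.1 τ))
    have h := P.toLin_smul (n : absoluteGaloisGroup F) (f.1 σ) (ρ₂ σ (g.1 τ))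
    change P.toLin (ρ₁ (n : absoluteGaloisGroup F) (f.1 σ)) (ρ₂ (n : absoluteGaloisGroup F) (ρ₂ σ (g.1 τ))) =
      ρ₃ (n : absoluteGaloisGroup F) (P.toLin (f.1 σ) (ρ₂ σ (g.1 τ))) at h
    rw [← h, ρ₁.smul_apply_eq_of_vanishing f hf σ n.2]
    have hc : σ⁻¹ * n * σ ∈ galUnr F := Subgroup.Normal.conj_mem' inferInstance (n : absoluteGaloisGroup F) n.2 σ
    have h2 : ρ₂ (n : absoluteGaloisGroup F) (ρ₂ σ (g.1 τ)) = ρ₂ σ (g.1 τ) := by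
      have h3 := ρ₂.smul_apply_eq_of_vanishing g hg τ hc
      change ρ₂.toRepresentation (n : absoluteGaloisGroup F) (ρ₂.toRepresentation σ (g.1 τ)) = ρ₂.toRepresentation σ (g.1 τ)
      change ρ₂.toRepresentation (σ⁻¹ * n * σ) (g.1 τ) = g.1 τ at h3
      rw [map_mul, map_mul, Module.End.mul_apply, Module.End.mul_apply] at h3
      have h4 := congrArg (ρ₂.toRepresentation σ) h3
      rwa [← Module.End.mul_apply (f := ρ₂.toRepresentation σ), ← map_mul, mul_inv_cancel, map_one,
        Module.End.one_apply] at h4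
    rw [h2]
  have hcoset : ∀ (σ τ : absoluteGaloisGroup F) {n n' : absoluteGaloisGroup F}, n ∈ galUnr F → n' ∈ galUnr F →
      (P.cupCocycle f g).1 (σ * n, τ * n') = (P.cupCocycle f g).1 (σ, τ) := by
    intro σ τ n n' hn hn'
    rw [cupCocycle_apply_eq_smul, cupCocycle_apply_eq_smul, ρ₁.apply_mul_eq_of_vanishing f hf σ hn,
      ρ₂.apply_mul_eq_of_vanishing g hg τ hn']
    change P.toLin (f.1 σ) (ρ₂ (σ * n) (g.1 τ)) = P.toLin (f.1 σ) (ρ₂ σ (g.1 τ))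
    have : ρ₂ (σ * n) (g.1 τ) = ρ₂ σ (g.1 τ) := by
      change ρ₂.toRepresentation (σ * n) (g.1 τ) = ρ₂.toRepresentation σ (g.1 τ)
      rw [map_mul, Module.End.mul_apply]
      exact congrArg (ρ₂.toRepresentation σ) (ρ₂.smul_apply_eq_of_vanishing g hg τ hn)
    rw [this]
  -- the descended function on `Q × Q`, `Q = Γ_F ⧸ I_F`
  let Q := absoluteGaloisGroup F ⧸ S
  let cbarFun : Q × Q → Representation.invariants (ρ₃.toRepresentation.comp S.subtype) :=
    fun q => ⟨(P.cupCocycle f g).1 (q.1.out, q.2.out), hval _ _⟩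
  have hcbar : ∀ σ τ : absoluteGaloisGroup F,
      cbarFun ((σ : Q), (τ : Q)) = ⟨(P.cupCocycle f g).1 (σ, τ), hval σ τ⟩ := by
    intro σ τ
    obtain ⟨n, hn⟩ := QuotientGroup.mk_out_eq_mul S σ
    obtain ⟨n', hn'⟩ := QuotientGroup.mk_out_eq_mul S τ
    refine Subtype.ext ?_
    change (P.cupCocycle f g).1 (((σ : Q)).out, ((τ : Q)).out) = (P.cupCocycle f g).1 (σ, τ)
    rw [hn, hn', hcoset σ τ n.2 n'.2]
  have hcont : Continuous cbarFun := by
    have hq : IsOpenQuotientMap (Prod.map (QuotientGroup.mk : absoluteGaloisGroup F → Q)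
        (QuotientGroup.mk : absoluteGaloisGroup F → Q)) :=
      QuotientGroup.isOpenQuotientMap_mk.prodMap QuotientGroup.isOpenQuotientMap_mk
    rw [← hq.continuous_comp_iff]
    have heq : cbarFun ∘ Prod.map QuotientGroup.mk QuotientGroup.mk =
        fun στ : absoluteGaloisGroup F × absoluteGaloisGroup F => ⟨(P.cupCocycle f g).1 στ, hval στ.1 στ.2⟩ := by
      funext στ
      exact hcbar στ.1 στ.2
    rw [heq]
    exact (P.cupCocycle f g).1.continuous.subtype_mk _
  -- the descended `2`-cocycle of `Q` with values in `C^{I_F}`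
  let Xq := (ρ₃.quotientInvariants S).toTopRep
  let cbar : contTwoCocycles Xq :=
    ⟨⟨cbarFun, hcont⟩, by
      intro q₁ q₂ q₃
      obtain ⟨σ₁, rfl⟩ := QuotientGroup.mk_surjective q₁
      obtain ⟨σ₂, rfl⟩ := QuotientGroup.mk_surjective q₂
      obtain ⟨σ₃, rfl⟩ := QuotientGroup.mk_surjective q₃
      change Xq.ρ (σ₁ : Q) (cbarFun ((σ₂ : Q), (σ₃ : Q))) + cbarFun ((σ₁ : Q), (σ₂ : Q) * (σ₃ : Q)) =
        cbarFun ((σ₁ : Q) * (σ₂ : Q), (σ₃ : Q)) + cbarFun ((σ₁ : Q), (σ₂ : Q))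
      rw [← QuotientGroup.mk_mul, ← QuotientGroup.mk_mul, hcbar, hcbar, hcbar, hcbar]
      refine Subtype.ext ?_
      change ρ₃ σ₁ ((P.cupCocycle f g).1 (σ₂, σ₃)) + (P.cupCocycle f g).1 (σ₁, σ₂ * σ₃) =
        (P.cupCocycle f g).1 (σ₁ * σ₂, σ₃) + (P.cupCocycle f g).1 (σ₁, σ₂)
      exact (P.cupCocycle f g).2 σ₁ σ₂ σ₃⟩
  -- `H²(Q, C^{I_F}) = 0`: `cd_p(Q) ≤ 1` and `C^{I_F}` is `p`-primary
  have hCS : IsPrimaryTorsion p (Representation.invariants (ρ₃.toRepresentation.comp S.subtype)) := by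
    intro w
    obtain ⟨r, hr⟩ := hC (w : C)
    refine ⟨r, Subtype.ext ?_⟩
    simpa using hr
  have hsub : Subsingleton (continuousCohomology 2 Xq) :=
    groupCdLE_one_quotient_galUnr F p _ (ρ₃.quotientInvariants S) hCS (Nat.lt_succ_self 1)
  have h0 : twoCocycleClass Xq cbar = 0 := Subsingleton.elim _ _
  -- inflate: the pull-back of `cbar` is the cup cocycle
  let ι : TopRep.res (ContinuousMonoidHom.quotientMk S : absoluteGaloisGroup F →* Q) Xq ⟶ ρ₃.toTopRep :=
    TopRep.ofHom ⟨Submodule.subtypeL _, fun _ => rfl⟩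
  have hpull : contTwoCocycles.pullback (ContinuousMonoidHom.quotientMk S) ι cbar = P.cupCocycle f g := by
    refine Subtype.ext (ContinuousMap.ext fun στ => ?_)
    obtain ⟨σ, τ⟩ := στ
    rw [contTwoCocycles.pullback_apply]
    change ((cbarFun ((σ : Q), (τ : Q)) : Representation.invariants (ρ₃.toRepresentation.comp S.subtype)) : C) = _
    rw [hcbar]
  have hmap := map_twoCocycleClass Xq (ContinuousMonoidHom.quotientMk S) ι cbar
  rw [h0, hpull] at hmap
  rw [cupProduct_oneCocycleClass_eq_twoCocycleClass, ← hmap]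
  exact map_zero _

end ContPairing

end Literature.NumberTheory.GaloisRepresentations
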